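/-
Copyright (c) 2026 The decomp-a2c cell. All rights reserved.
Released under Apache 2.0 license as described in the file LICENSE.
-/
import Summits.AtomisticToContinuum.Crystallization.Theorems.ChartedZeroExcessLayeredLatticeLiouvilleWN

/-!
# ChartedZeroExcessLayeredLatticeLiouville — part WO «CarrierCheck»: the column fluxes of part WC evaluated on a MODE FIELD agree with the box
  fluxes of part VT (decomp-a2c-lens-2, g58; helper of stmt-AtomisticToContinuum-26636, leaf (PC) `ProfileComparisonAt` below (LD′)
  `ModalLipschitzZ`; the cheapest falsifier of the (PC) plan, critic row 1007 (v), SETTLED POSITIVELY)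

The proof plan for (PC) (memo NODE-g58d §3) compares the column flux data of a harmonic field `φ` (part WC: `colFlux`, `colPlanar` over a
carrier `T`, kernel-weighted sums `siteFlux` / `planarFlux`) with the flux bookkeeping of the mode `modeField g cf` (part VT: `columnFlux`,
`boxSlope`, box sums of `chainK` / `slopeK` of width `⌊ϱ/c⌋₊`).  The two conventions AGREE on mode fields, exactly:

* `planarFlux_modeField : planarFlux ϱ a b w (modeField g cf) X β = slopeK ϱ a b w X β g` (the profile cancels in planar differences);
* `chainFlux_modeField_col : chainFlux ϱ a b w T (modeField g cf γ) m = chainFlux ϱ a b w T cf m` (the affine part is constant along a column);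
* ★ `colPlanar_modeField : colPlanar ϱ a b w T (modeField g cf) γ m = boxSlope ϱ a b w ⌊ϱ/c⌋₊ g m` and
  ★ `colFlux_modeField : colFlux ϱ a b w T (modeField g cf) γ m = columnFlux ϱ a b w ⌊ϱ/c⌋₊ g cf m` for every carrier
  `T ⊇ [m − ⌊ϱ/c⌋₊, m + 1 + ⌊ϱ/c⌋₊]` and every column `γ`;
* `colFlux_modeField_eq_of_harmonic`: for a mode field harmonic on `Set.univ` (part VV's extraction) the column flux through every such gap is
  the SAME vector `columnFlux … 0` — so the flux drift `h(m)` of the plan has NO self-fibre term (row 1007 (v)).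
-/

namespace Summit.AtomisticToContinuum.Crystallization.Theorems.ChartedZeroExcessLayeredLatticeLiouville

open Summit.AtomisticToContinuum.Crystallization.Theorems.ChartedPlanarOrderRigidityDoor (E3)
open Finset
open scoped InnerProductSpace RealInnerProductSpace BigOperators

noncomputable section CarrierCheck

variable {c : ℝ} {a b : E3} {w : ℤ → E3}

/-! ### WO.1  Mode fields through the WC fluxes -/

/-- planar differences of a mode field are the slope differences. [formal bookkeeping] -/
theorem modeField_sub_modeField_layer (g : Fin 2 → E3) (cf : ℤ → E3) (δ γ : Cell 2) (β : ℤ) :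
    modeField g cf δ β - modeField g cf γ β = ∑ j, (((δ j - γ j : ℤ)) : ℝ) • g j := by
  simp only [modeField, add_sub_add_right_eq_sub, Int.cast_sub, sub_smul, sum_sub_distrib]

/-- a mode field is constant along a column up to its profile: `modeField g cf γ = fun α => v + cf α`. [formal bookkeeping] -/
theorem modeField_col_sub (g : Fin 2 → E3) (cf : ℤ → E3) (γ : Cell 2) (α β : ℤ) :
    modeField g cf γ β - modeField g cf γ α = cf β - cf α := by
  simp only [modeField, add_sub_add_left_eq_sub]

/-- the planar flux (part WC) of a mode field is the slope flux (part VT). [this file, g58] -/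
theorem planarFlux_modeField (ϱ : ℝ) (a b : E3) (w : ℤ → E3) (g : Fin 2 → E3) (cf : ℤ → E3) (X : Cell 2 × ℤ) (β : ℤ) :
    planarFlux ϱ a b w (modeField g cf) X β = slopeK ϱ a b w X β g := by
  simp only [planarFlux, slopeK, modeField_sub_modeField_layer]

/-- the chain flux of a column of a mode field is the chain flux of its profile. [this file, g58] -/
theorem chainFlux_modeField_col (ϱ : ℝ) (a b : E3) (w : ℤ → E3) (T : Finset ℤ) (g : Fin 2 → E3) (cf : ℤ → E3) (γ : Cell 2) (m : ℤ) :
    chainFlux ϱ a b w T (modeField g cf γ) m = chainFlux ϱ a b w T cf m := by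
  simp only [chainFlux, modeField_col_sub]

/-- ★ CARRIER CHECK, planar part: the column planar flux (part WC) of a mode field through gap `m`, over any carrier containing the band box, is
EXACTLY the box slope flux of part VT. [this file, g58] -/
theorem colPlanar_modeField (hc : 0 < c) (hL : IsLayeredCrystal c a b w) {ϱ : ℝ} (g : Fin 2 → E3) (cf : ℤ → E3) {T : Finset ℤ} {m : ℤ}
    (hT : Icc (m - ⌊ϱ / c⌋₊) (m + 1 + ⌊ϱ / c⌋₊) ⊆ T) (γ : Cell 2) :
    colPlanar ϱ a b w T (modeField g cf) γ m = boxSlope ϱ a b w ⌊ϱ / c⌋₊ g m := by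
  rw [← gapFlux_slopeK_eq_boxSlope hc hL g hT]
  simp only [colPlanar, cutSum, gapFlux, planarFlux_modeField, slopeK_translate]

/-- ★ CARRIER CHECK, full flux: the column flux (part WC) of a mode field through gap `m`, over any carrier containing the band box, is EXACTLY the
column flux `columnFlux` of part VT (box chain flux + box slope flux). [this file, g58] -/
theorem colFlux_modeField (hc : 0 < c) (hL : IsLayeredCrystal c a b w) {ϱ : ℝ} (g : Fin 2 → E3) (cf : ℤ → E3) {T : Finset ℤ} {m : ℤ}
    (hT : Icc (m - ⌊ϱ / c⌋₊) (m + 1 + ⌊ϱ / c⌋₊) ⊆ T) (γ : Cell 2) :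
    colFlux ϱ a b w T (modeField g cf) γ m = columnFlux ϱ a b w ⌊ϱ / c⌋₊ g cf m := by
  rw [colFlux_eq_chainFlux_add hc hL, chainFlux_modeField_col, chainFlux_eq_box hc hL cf hT, colPlanar_modeField hc hL g cf hT, columnFlux_eq]

/-- consequence: for a mode field harmonic on all of `Cell 2 × ℤ` (part VV's extraction) the WC column flux through EVERY gap whose band box lies
in the carrier, on EVERY column, is one and the same vector — the flux drift of the (PC) plan has no self-fibre term (critic row 1007 (v)).
[this file, g58] -/
theorem colFlux_modeField_eq_of_harmonic (hc : 0 < c) (hL : IsLayeredCrystal c a b w) (ϱ : ℝ) (g : Fin 2 → E3) (cf : ℤ → E3)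
    (hH : IsTruncHarmonicZ ϱ a b w (modeField g cf) Set.univ) {T : Finset ℤ} {m : ℤ} (hT : Icc (m - ⌊ϱ / c⌋₊) (m + 1 + ⌊ϱ / c⌋₊) ⊆ T)
    (γ : Cell 2) : colFlux ϱ a b w T (modeField g cf) γ m = columnFlux ϱ a b w ⌊ϱ / c⌋₊ g cf 0 := by
  rw [colFlux_modeField hc hL g cf hT, columnFlux_const_of_harmonic hc hL ϱ g cf hH]

/-! ### WO.2  The closed statement of this part -/

/-- The content of part WO as one closed proposition: on mode fields the WC column fluxes are the VT box fluxes. -/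
def CarrierCheckShape : Prop :=
  ∀ c : ℝ, 0 < c → ∀ (a b : E3) (w : ℤ → E3), IsLayeredCrystal c a b w → ∀ (ϱ : ℝ) (g : Fin 2 → E3) (cf : ℤ → E3) (T : Finset ℤ) (m : ℤ),
    Icc (m - ⌊ϱ / c⌋₊) (m + 1 + ⌊ϱ / c⌋₊) ⊆ T → ∀ γ : Cell 2,
      colPlanar ϱ a b w T (modeField g cf) γ m = boxSlope ϱ a b w ⌊ϱ / c⌋₊ g m ∧
        colFlux ϱ a b w T (modeField g cf) γ m = columnFlux ϱ a b w ⌊ϱ / c⌋₊ g cf m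

/-- WO holds. [this file, g58] -/
theorem carrierCheckShape_holds : CarrierCheckShape :=
  fun _c hc _a _b _w hL _ϱ g cf _T _m hT γ => ⟨colPlanar_modeField hc hL g cf hT γ, colFlux_modeField hc hL g cf hT γ⟩

end CarrierCheck

end Summit.AtomisticToContinuum.Crystallization.Theorems.ChartedZeroExcessLayeredLatticeLiouville
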